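import Summits.BirchSwinnertonDyer.BirchSwinnertonDyer.Theorems.UniversalToricDescentAcDualMuZeroCriterion
import Summits.BirchSwinnertonDyer.Rank1Residual.X11b.AnticyclotomicSelmerDual
import Mathlib.Algebra.Module.ZMod
import Mathlib.Algebra.CharP.Lemmas
import HarnessLib

/-!
# ONE-LAYER `μ`-CRITERION on Castella's anticyclotomic Selmer group: few `γ^{pⁿ}`-invariants in `Sel[p]` at ONE layer
# force `X_ac` to be `Λ`-torsion with `μ = 0`

LEAD `bsd-wall-utd-p1` g20, support for the crux `TwinAlgMuZeroAtThree` (stmt-BirchSwinnertonDyer-24254; crux idea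
`residual-layer-criterion`, utd-idea g52) — the criterion ON THE ROUTE'S OWN OBJECT, with no residual Selmer structure and
no control theorem: for an elliptic curve `W` over a number field `K`, a `ℤ_p`-extension `κ` with topological generator `γ`, a
place `𝔭` and a finite imprimitivity set `Σ`, let `Sel = Sel_𝔭^Σ(K_∞, E[p^∞])` (`AcSelmer.selmerAc W p κ 𝔭 Σ`). If for ONE `n` the
classes `s ∈ Sel` with `p • s = 0` and `conj_{γ^{pⁿ}} s = s` are finite and FEWER THAN `p^{pⁿ}`, then `Sel[p]` is finite, hence
(tree `…AcDualMuZero.isTorsion_and_exists_generator_of_finite_pTorsion`) `X_ac^Σ` is `Λ`-torsion and `Ch_Λ(X_ac^Σ)·R₀⟦T⟧ = (g)`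
with a norm-one coefficient of `g` — the conclusion shape of `TwinAlgMuZeroAtThree`.

Mechanism (pure linear algebra, §1): on the `𝔽_p`-space `V = Sel[p]` the operator `N = conj_γ − 1` is locally nilpotent (tree
`isLocNil_conjSelmerAc_sub_one`) and `N^{pⁿ} = conj_{γ^{pⁿ}} − 1` (Frobenius: `(X − 1)^{pⁿ} = X^{pⁿ} − 1` over `𝔽_p`); for a
locally nilpotent `N` on a vector space over a field `k`, if `#ker N^m < #k^m` then the chain `ker N ⊊ ker N² ⊊ …` must
stabilise before step `m` (each strict step multiplies the cardinality by at least `#k`), and once `ker N^j = ker N^{j+1}` the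
chain is constant, so `V = ⋃ ker N^i = ker N^m` is finite (`finite_of_natCard_ker_pow_lt`). THEOREMS ONLY; no `sorry`, no
named fact; imports no `Theses` module. BSD is proved for no curve by this file. References: Greenberg LNM 1716 §1 (p. 60),
§3 Prop. 3.8 (the `Sel = 0` prototype); Greenberg–Vatsal 2000 Prop. (2.8); folklore.
-/

noncomputable section

open scoped Classical

set_option linter.dupNamespace false
set_option autoImplicit false

namespace Summit.BirchSwinnertonDyer.BirchSwinnertonDyer.Theorems.UniversalToricDescentOneLayerCriterion

/-! ## §1 Linear algebra: locally nilpotent operators with a small kernel power -/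

section LinearAlgebra

variable {k : Type*} [Field k] {V : Type*} [AddCommGroup V] [Module k V]

/-- A non-trivial module over a field `k` has at least `#k` elements (a line `k • v`, `v ≠ 0`, embeds `k`). [folklore] -/
theorem natCard_le_of_nontrivial [Finite V] [Nontrivial V] : Nat.card k ≤ Nat.card V := by
  obtain ⟨v, hv⟩ := exists_ne (0 : V)
  refine Nat.card_le_card_of_injective (fun c : k => c • v) fun c d hcd => ?_
  have hcd' : c • v = d • v := hcd
  by_contra hne
  have h : (c - d) • v = 0 := by rw [sub_smul, hcd', sub_self]
  rcases smul_eq_zero.mp h with h0 | h0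
  · exact hne (sub_eq_zero.mp h0)
  · exact hv h0

/-- A STRICT inclusion of submodules of a finite module over `k` costs a factor `#k` in cardinality. [folklore] -/
theorem natCard_mul_le_of_lt {A B : Submodule k V} [Finite B] (hAB : A < B) :
    Nat.card k * Nat.card A ≤ Nat.card B := by
  -- `A` as a submodule of `B`
  let A' : Submodule k B := A.comap B.subtype
  have hle : A ≤ B := hAB.le
  have hcard : Nat.card B = Nat.card A' * Nat.card (B ⧸ A') := Submodule.card_eq_card_quotient_mul_card A'
  have hA' : Nat.card A' = Nat.card A := by
    refine Nat.card_congr ⟨fun x => ⟨(x : B), x.2⟩, fun y => ⟨⟨y, hle y.2⟩, y.2⟩, fun x => ?_, fun y => ?_⟩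
    · rfl
    · rfl
  haveI : Nontrivial (B ⧸ A') := by
    obtain ⟨b, hbB, hbA⟩ := SetLike.exists_of_lt hAB
    refine ⟨⟨Submodule.Quotient.mk ⟨b, hbB⟩, 0, fun h => hbA ?_⟩⟩
    rw [Submodule.Quotient.mk_eq_zero, Submodule.mem_comap] at h
    exact h
  haveI : Finite (B ⧸ A') := Finite.of_surjective _ (Submodule.mkQ_surjective A')
  rw [hcard, hA', mul_comm (Nat.card k) (Nat.card A)]
  exact Nat.mul_le_mul_left _ (natCard_le_of_nontrivial (k := k) (V := B ⧸ A'))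

/-- Kernels of powers of an operator: monotone in the exponent. [folklore] -/
theorem ker_pow_mono (N : V →ₗ[k] V) {i j : ℕ} (hij : i ≤ j) : LinearMap.ker (N ^ i) ≤ LinearMap.ker (N ^ j) := by
  intro v hv
  rw [LinearMap.mem_ker] at hv ⊢
  obtain ⟨d, rfl⟩ := Nat.exists_eq_add_of_le hij
  rw [add_comm, pow_add, Module.End.mul_apply, hv, map_zero]

/-- Once two consecutive kernels agree, the chain of kernels is constant from there on. [folklore] -/
theorem ker_pow_add_eq_of_ker_pow_eq (N : V →ₗ[k] V) {j : ℕ}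
    (h : LinearMap.ker (N ^ j) = LinearMap.ker (N ^ (j + 1))) :
    ∀ i : ℕ, LinearMap.ker (N ^ (j + i)) = LinearMap.ker (N ^ j)
  | 0 => by rw [add_zero]
  | i + 1 => by
    apply le_antisymm
    · intro v hv
      rw [LinearMap.mem_ker, ← add_assoc, pow_succ, Module.End.mul_apply] at hv
      -- `N v ∈ ker N^{j+i} = ker N^j`, so `v ∈ ker N^{j+1} = ker N^j`
      have hNv : N v ∈ LinearMap.ker (N ^ j) := by
        rw [← ker_pow_add_eq_of_ker_pow_eq N h i, LinearMap.mem_ker]; exact hv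
      rw [h, LinearMap.mem_ker, pow_succ, Module.End.mul_apply]
      exact LinearMap.mem_ker.mp hNv
    · exact ker_pow_mono N (Nat.le_add_right j (i + 1))

/-- **Locally nilpotent operator with a small kernel power.** If `N` is locally nilpotent on the `k`-module `V` and, for some
`m`, `ker N^m` is finite with `#ker N^m < #k^m`, then `V` is finite (indeed `V = ker N^m`). [folklore] -/
theorem finite_of_natCard_ker_pow_lt (N : V →ₗ[k] V) (hnil : ∀ v : V, ∃ i : ℕ, (N ^ i) v = 0) (m : ℕ)
    [Finite (LinearMap.ker (N ^ m))] (hlt : Nat.card (LinearMap.ker (N ^ m)) < Nat.card k ^ m) : Finite V := by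
  -- kernels below `m` are finite
  have hmono : ∀ {i j : ℕ}, i ≤ j → LinearMap.ker (N ^ i) ≤ LinearMap.ker (N ^ j) :=
    fun hij => ker_pow_mono N hij
  have hfin : ∀ i ≤ m, Finite (LinearMap.ker (N ^ i)) := fun i hi =>
    Finite.of_injective (Submodule.inclusion (hmono hi)) (Submodule.inclusion_injective _)
  -- if the chain were strict up to `m`, the kernels would be too big
  have hgrow : ∀ j ≤ m, (∀ i < j, LinearMap.ker (N ^ i) ≠ LinearMap.ker (N ^ (i + 1))) →
      Nat.card k ^ j ≤ Nat.card (LinearMap.ker (N ^ j)) := by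
    intro j hj hstrict
    induction j with
    | zero =>
      rw [pow_zero]
      haveI := hfin 0 hj
      exact Nat.one_le_iff_ne_zero.mpr (Nat.card_pos (α := LinearMap.ker (N ^ 0))).ne'
    | succ j ih =>
      have hj' : j ≤ m := Nat.le_of_succ_le hj
      haveI := hfin (j + 1) hj
      have hlt' : LinearMap.ker (N ^ j) < LinearMap.ker (N ^ (j + 1)) :=
        lt_of_le_of_ne (hmono (Nat.le_succ j)) (hstrict j (Nat.lt_succ_self j))
      calc Nat.card k ^ (j + 1) = Nat.card k * Nat.card k ^ j := by ring
        _ ≤ Nat.card k * Nat.card (LinearMap.ker (N ^ j)) :=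
            Nat.mul_le_mul_left _ (ih hj' fun i hi => hstrict i (Nat.lt_succ_of_lt hi))
        _ ≤ Nat.card (LinearMap.ker (N ^ (j + 1))) := natCard_mul_le_of_lt hlt'
  -- hence the chain stabilises at some `j < m`
  have hstab : ∃ j < m, LinearMap.ker (N ^ j) = LinearMap.ker (N ^ (j + 1)) := by
    by_contra h
    push Not at h
    exact absurd (hgrow m le_rfl h) (not_le.mpr hlt)
  obtain ⟨j, hjm, hj⟩ := hstab
  -- so `V = ker N^j ≤ ker N^m`
  have hall : ∀ v : V, v ∈ LinearMap.ker (N ^ m) := by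
    intro v
    obtain ⟨i, hi⟩ := hnil v
    have hvi : v ∈ LinearMap.ker (N ^ (j + i)) := hmono (Nat.le_add_left i j) (LinearMap.mem_ker.mpr hi)
    rw [ker_pow_add_eq_of_ker_pow_eq N hj i] at hvi
    exact hmono hjm.le hvi
  exact Finite.of_injective (fun v : V => (⟨v, hall v⟩ : LinearMap.ker (N ^ m))) fun v w h => by
    simpa using congrArg Subtype.val h


/-- Under the hypotheses of `finite_of_natCard_ker_pow_lt`, in fact `V = ker N^m`: every vector is killed by `N^m`. [folklore] -/
theorem ker_pow_eq_top_of_natCard_ker_pow_lt (N : V →ₗ[k] V) (hnil : ∀ v : V, ∃ i : ℕ, (N ^ i) v = 0) (m : ℕ)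
    [Finite (LinearMap.ker (N ^ m))] (hlt : Nat.card (LinearMap.ker (N ^ m)) < Nat.card k ^ m) :
    LinearMap.ker (N ^ m) = ⊤ := by
  -- same argument as `finite_of_natCard_ker_pow_lt`, keeping the conclusion `V ≤ ker N^m`
  have hmono : ∀ {i j : ℕ}, i ≤ j → LinearMap.ker (N ^ i) ≤ LinearMap.ker (N ^ j) :=
    fun hij => ker_pow_mono N hij
  have hfin : ∀ i ≤ m, Finite (LinearMap.ker (N ^ i)) := fun i hi =>
    Finite.of_injective (Submodule.inclusion (hmono hi)) (Submodule.inclusion_injective _)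
  have hgrow : ∀ j ≤ m, (∀ i < j, LinearMap.ker (N ^ i) ≠ LinearMap.ker (N ^ (i + 1))) →
      Nat.card k ^ j ≤ Nat.card (LinearMap.ker (N ^ j)) := by
    intro j hj hstrict
    induction j with
    | zero =>
      rw [pow_zero]
      haveI := hfin 0 hj
      exact Nat.one_le_iff_ne_zero.mpr (Nat.card_pos (α := LinearMap.ker (N ^ 0))).ne'
    | succ j ih =>
      have hj' : j ≤ m := Nat.le_of_succ_le hj
      haveI := hfin (j + 1) hj
      have hlt' : LinearMap.ker (N ^ j) < LinearMap.ker (N ^ (j + 1)) :=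
        lt_of_le_of_ne (hmono (Nat.le_succ j)) (hstrict j (Nat.lt_succ_self j))
      calc Nat.card k ^ (j + 1) = Nat.card k * Nat.card k ^ j := by ring
        _ ≤ Nat.card k * Nat.card (LinearMap.ker (N ^ j)) :=
            Nat.mul_le_mul_left _ (ih hj' fun i hi => hstrict i (Nat.lt_succ_of_lt hi))
        _ ≤ Nat.card (LinearMap.ker (N ^ (j + 1))) := natCard_mul_le_of_lt hlt'
  have hstab : ∃ j < m, LinearMap.ker (N ^ j) = LinearMap.ker (N ^ (j + 1)) := by
    by_contra h
    push Not at h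
    exact absurd (hgrow m le_rfl h) (not_le.mpr hlt)
  obtain ⟨j, hjm, hj⟩ := hstab
  rw [eq_top_iff]
  intro v _
  obtain ⟨i, hi⟩ := hnil v
  have hvi : v ∈ LinearMap.ker (N ^ (j + i)) := hmono (Nat.le_add_left i j) (LinearMap.mem_ker.mpr hi)
  rw [ker_pow_add_eq_of_ker_pow_eq N hj i] at hvi
  exact hmono hjm.le hvi

end LinearAlgebra

/-! ## §2 Frobenius: `(φ − 1)^{pⁿ} = φ^{pⁿ} − 1` on an `𝔽_p`-module -/

/-- On a module over `ZMod p` (`p` prime), `(φ − 1)^{pⁿ} = φ^{pⁿ} − 1` for every linear endomorphism `φ`. [folklore] -/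
theorem sub_one_pow_prime_pow {p : ℕ} [Fact p.Prime] {V : Type*} [AddCommGroup V] [Module (ZMod p) V]
    (φ : V →ₗ[ZMod p] V) (n : ℕ) : (φ - 1) ^ p ^ n = φ ^ p ^ n - 1 := by
  -- `(X − 1)^{pⁿ} = X^{pⁿ} − 1` in `𝔽_p[X]`, evaluated at `φ`
  have h : ((Polynomial.X : Polynomial (ZMod p)) - 1) ^ p ^ n = Polynomial.X ^ p ^ n - 1 := by
    rw [sub_pow_char_pow_of_commute (p := p) (n := n) (Commute.one_right (Polynomial.X : Polynomial (ZMod p))),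
      one_pow]
  have h' := congrArg (Polynomial.aeval φ) h
  simpa only [map_pow, map_sub, Polynomial.aeval_X, map_one] using h'

/-! ## §3 The criterion on Castella's anticyclotomic Selmer group -/

section Selmer

open NumberField IsDedekindDomain Field Literature.NumberTheory.EllipticCurves
  Summit.BirchSwinnertonDyer.Rank1Residual.X11b Summit.BirchSwinnertonDyer.Rank1Residual.X11b.AcSelmer
  Summit.BirchSwinnertonDyer.BirchSwinnertonDyer.Theorems.UniversalToricDescentAcDualMuZero

universe u

variable {K : Type u} [Field K] [NumberField K] (W : WeierstrassCurve K) (p : ℕ) [Fact p.Prime]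
  (κ : ZpExtension K p) (𝔭 : HeightOneSpectrum (𝓞 K)) (S : Set (HeightOneSpectrum (𝓞 K)))
  (γ : absoluteGaloisGroup K) [hγ : Fact (κ.IsTopGenerator γ)]

/-- **`Sel[p]` is finite as soon as ONE layer has few invariants.** If for some `n` the classes `s ∈ Sel_𝔭^Σ(K_∞, E[p^∞])`
with `p • s = 0` and `conj_{γ^{pⁿ}} s = s` form a finite set with fewer than `p^{pⁿ}` elements, then ALL of `Sel[p]` is finite.
[cite: GreenbergLNM1716, §1 (p. 60)] -/
theorem finite_pTorsion_of_natCard_layerInvariants_lt (n : ℕ)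
    (hfin : Set.Finite {s : selmerAc W p κ 𝔭 S |
      p • s = 0 ∧ W.conjH1 p κ.kerSubgroup (γ ^ p ^ n) s = s})
    (hlt : Nat.card {s : selmerAc W p κ 𝔭 S //
      p • s = 0 ∧ W.conjH1 p κ.kerSubgroup (γ ^ p ^ n) s = s} < p ^ p ^ n) :
    Set.Finite {s : selmerAc W p κ 𝔭 S | p • s = 0} := by
  -- the `𝔽_p`-space `V = Sel[p]`
  let Vsub : AddSubgroup (selmerAc W p κ 𝔭 S) := AddSubgroup.torsionBy (selmerAc W p κ 𝔭 S) (p : ℕ)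
  have hmemV : ∀ s : selmerAc W p κ 𝔭 S, s ∈ Vsub ↔ p • s = 0 := fun s => AddSubgroup.torsionBy.nsmul_iff
  letI : Module (ZMod p) Vsub := AddSubgroup.torsionBy.zmodModule
  -- `conj_γ` restricted to `V`, as a `ZMod p`-linear map
  let ψ : AddMonoid.End (selmerAc W p κ 𝔭 S) := conjSelmerAc W p κ 𝔭 S γ
  have hψV : ∀ v : Vsub, ψ (v : selmerAc W p κ 𝔭 S) ∈ Vsub := fun v => by
    rw [hmemV, ← map_nsmul, (hmemV _).mp v.2, map_zero]
  let φadd : Vsub →+ Vsub :=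
    { toFun := fun v => ⟨ψ (v : selmerAc W p κ 𝔭 S), hψV v⟩
      map_zero' := Subtype.ext (map_zero ψ)
      map_add' := fun v w => Subtype.ext (map_add ψ _ _) }
  let φ : Vsub →ₗ[ZMod p] Vsub := φadd.toZModLinearMap p
  have hφpow : ∀ (i : ℕ) (v : Vsub), (((φ ^ i) v : Vsub) : selmerAc W p κ 𝔭 S) = (ψ ^ i) (v : selmerAc W p κ 𝔭 S) := by
    intro i
    induction i with
    | zero => intro v; rfl
    | succ i ih =>
      intro v
      rw [pow_succ, Module.End.mul_apply, pow_succ, AddMonoid.End.coe_mul, Function.comp_apply, ih (φ v)]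
      rfl
  -- `N = φ − 1` is locally nilpotent (tree: `isLocNil_conjSelmerAc_sub_one`)
  set N : Vsub →ₗ[ZMod p] Vsub := φ - 1 with hN
  have hNpow : ∀ (i : ℕ) (v : Vsub),
      (((N ^ i) v : Vsub) : selmerAc W p κ 𝔭 S) = ((ψ - 1) ^ i) (v : selmerAc W p κ 𝔭 S) := by
    intro i
    induction i with
    | zero => intro v; rfl
    | succ i ih =>
      intro v
      rw [pow_succ, Module.End.mul_apply, pow_succ, AddMonoid.End.coe_mul, Function.comp_apply, ih (N v)]
      rfl
  have hnil : ∀ v : Vsub, ∃ i : ℕ, (N ^ i) v = 0 := by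
    intro v
    obtain ⟨i, hi⟩ := (isLocNil_conjSelmerAc_sub_one W p κ 𝔭 S hγ.out).nil (v : selmerAc W p κ 𝔭 S)
    exact ⟨i, Subtype.ext (by rw [hNpow]; exact hi)⟩
  -- `ker N^{pⁿ}` = the layer invariants in `Sel[p]`
  have hker : ∀ v : Vsub, v ∈ LinearMap.ker (N ^ p ^ n) ↔
      W.conjH1 p κ.kerSubgroup (γ ^ p ^ n) (v : selmerAc W p κ 𝔭 S) = (v : selmerAc W p κ 𝔭 S) := by
    intro v
    rw [LinearMap.mem_ker, hN, sub_one_pow_prime_pow, LinearMap.sub_apply, sub_eq_zero, Module.End.one_apply,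
      Subtype.ext_iff, Subtype.ext_iff, hφpow, coe_conjSelmerAc_pow_apply]
  -- transport finiteness and the count
  let e : LinearMap.ker (N ^ p ^ n) ≃
      {s : selmerAc W p κ 𝔭 S // p • s = 0 ∧ W.conjH1 p κ.kerSubgroup (γ ^ p ^ n) s = s} :=
    { toFun := fun v => ⟨(v : Vsub), (hmemV _).mp (v : Vsub).2, (hker v).mp v.2⟩
      invFun := fun s => ⟨⟨s.1, (hmemV _).mpr s.2.1⟩, (hker _).mpr s.2.2⟩
      left_inv := fun v => rfl
      right_inv := fun s => rfl }
  haveI : Finite {s : selmerAc W p κ 𝔭 S // p • s = 0 ∧ W.conjH1 p κ.kerSubgroup (γ ^ p ^ n) s = s} :=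
    hfin.to_subtype
  haveI : Finite (LinearMap.ker (N ^ p ^ n)) := Finite.of_equiv _ e.symm
  have hcard : Nat.card (LinearMap.ker (N ^ p ^ n)) < Nat.card (ZMod p) ^ p ^ n := by
    rw [Nat.card_congr e, Nat.card_zmod]; exact hlt
  haveI : Finite Vsub := finite_of_natCard_ker_pow_lt N hnil (p ^ n) hcard
  -- `Sel[p] = V`
  have : {s : selmerAc W p κ 𝔭 S | p • s = 0} = Set.range (fun v : Vsub => (v : selmerAc W p κ 𝔭 S)) := by
    ext s
    simp only [Set.mem_setOf_eq, Set.mem_range]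
    constructor
    · exact fun hs => ⟨⟨s, (hmemV s).mpr hs⟩, rfl⟩
    · rintro ⟨v, rfl⟩; exact (hmemV _).mp v.2
  rw [this]
  exact Set.finite_range _

/-- **ONE-LAYER `μ`-CRITERION for `X_ac^Σ`.** For finite `Σ`: if for some `n` the `γ^{pⁿ}`-invariant classes of
`Sel_𝔭^Σ(K_∞, E[p^∞])[p]` are finite and fewer than `p^{pⁿ}`, then `X_ac^Σ = XAc W p κ 𝔭 Σ γ` is `Λ`-torsion and
`Ch_Λ(X_ac^Σ)·R₀⟦T⟧ = (g)` for some `g` with a coefficient of norm `1` (`μ = 0`) — the conclusion shape of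
`TwinAlgMuZeroAtThree` at `(W, 𝔭)`. [cite: GreenbergLNM1716, §1 (p. 60), §3 Prop. 3.8] [cite: GreenbergVatsal2000, §2 Prop. (2.8)] -/
theorem isTorsion_and_exists_generator_of_natCard_layerInvariants_lt [W.IsElliptic] (hS : S.Finite) (n : ℕ)
    (hfin : Set.Finite {s : selmerAc W p κ 𝔭 S |
      p • s = 0 ∧ W.conjH1 p κ.kerSubgroup (γ ^ p ^ n) s = s})
    (hlt : Nat.card {s : selmerAc W p κ 𝔭 S //
      p • s = 0 ∧ W.conjH1 p κ.kerSubgroup (γ ^ p ^ n) s = s} < p ^ p ^ n) :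
    Module.IsTorsion (IwasawaAlgebra p) (XAc W p κ 𝔭 S γ) ∧
      ∃ g : UnrSeries p,
        (XAc.charIdeal W p κ 𝔭 S γ).map (PowerSeries.map (Halves.toUnr p)) = Ideal.span {g} ∧
          ∃ i : ℕ, ‖((PowerSeries.coeff i g : unrIntegers p) : ℂ_[p])‖ = 1 :=
  isTorsion_and_exists_generator_of_finite_pTorsion W p κ 𝔭 S γ hS
    (finite_pTorsion_of_natCard_layerInvariants_lt W p κ 𝔭 S γ n hfin hlt)


/-- **… and then ALL of `Sel[p]` is `γ^{pⁿ}`-invariant, so `#Sel[p] < p^{pⁿ}`** (a bound on the `𝔽_p`-dimension of `Sel[p]`, i.e. on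
`λ(X_ac^Σ)` plus the finite part, read at one layer). [cite: GreenbergLNM1716, §1 (p. 60)] -/
theorem natCard_pTorsion_lt_of_natCard_layerInvariants_lt (n : ℕ)
    (hfin : Set.Finite {s : selmerAc W p κ 𝔭 S |
      p • s = 0 ∧ W.conjH1 p κ.kerSubgroup (γ ^ p ^ n) s = s})
    (hlt : Nat.card {s : selmerAc W p κ 𝔭 S //
      p • s = 0 ∧ W.conjH1 p κ.kerSubgroup (γ ^ p ^ n) s = s} < p ^ p ^ n) :
    {s : selmerAc W p κ 𝔭 S | p • s = 0} =
        {s : selmerAc W p κ 𝔭 S | p • s = 0 ∧ W.conjH1 p κ.kerSubgroup (γ ^ p ^ n) s = s} ∧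
      Nat.card {s : selmerAc W p κ 𝔭 S // p • s = 0} < p ^ p ^ n := by
  -- rebuild the `𝔽_p`-space `V = Sel[p]` and `N = conj_γ − 1` exactly as in `finite_pTorsion_of_natCard_layerInvariants_lt`
  let Vsub : AddSubgroup (selmerAc W p κ 𝔭 S) := AddSubgroup.torsionBy (selmerAc W p κ 𝔭 S) (p : ℕ)
  have hmemV : ∀ s : selmerAc W p κ 𝔭 S, s ∈ Vsub ↔ p • s = 0 := fun s => AddSubgroup.torsionBy.nsmul_iff
  letI : Module (ZMod p) Vsub := AddSubgroup.torsionBy.zmodModule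
  let ψ : AddMonoid.End (selmerAc W p κ 𝔭 S) := conjSelmerAc W p κ 𝔭 S γ
  have hψV : ∀ v : Vsub, ψ (v : selmerAc W p κ 𝔭 S) ∈ Vsub := fun v => by
    rw [hmemV, ← map_nsmul, (hmemV _).mp v.2, map_zero]
  let φadd : Vsub →+ Vsub :=
    { toFun := fun v => ⟨ψ (v : selmerAc W p κ 𝔭 S), hψV v⟩
      map_zero' := Subtype.ext (map_zero ψ)
      map_add' := fun v w => Subtype.ext (map_add ψ _ _) }
  let φ : Vsub →ₗ[ZMod p] Vsub := φadd.toZModLinearMap p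
  have hφpow : ∀ (i : ℕ) (v : Vsub), (((φ ^ i) v : Vsub) : selmerAc W p κ 𝔭 S) = (ψ ^ i) (v : selmerAc W p κ 𝔭 S) := by
    intro i
    induction i with
    | zero => intro v; rfl
    | succ i ih =>
      intro v
      rw [pow_succ, Module.End.mul_apply, pow_succ, AddMonoid.End.coe_mul, Function.comp_apply, ih (φ v)]
      rfl
  set N : Vsub →ₗ[ZMod p] Vsub := φ - 1 with hN
  have hNpow : ∀ (i : ℕ) (v : Vsub),
      (((N ^ i) v : Vsub) : selmerAc W p κ 𝔭 S) = ((ψ - 1) ^ i) (v : selmerAc W p κ 𝔭 S) := by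
    intro i
    induction i with
    | zero => intro v; rfl
    | succ i ih =>
      intro v
      rw [pow_succ, Module.End.mul_apply, pow_succ, AddMonoid.End.coe_mul, Function.comp_apply, ih (N v)]
      rfl
  have hnil : ∀ v : Vsub, ∃ i : ℕ, (N ^ i) v = 0 := by
    intro v
    obtain ⟨i, hi⟩ := (isLocNil_conjSelmerAc_sub_one W p κ 𝔭 S hγ.out).nil (v : selmerAc W p κ 𝔭 S)
    exact ⟨i, Subtype.ext (by rw [hNpow]; exact hi)⟩
  have hker : ∀ v : Vsub, v ∈ LinearMap.ker (N ^ p ^ n) ↔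
      W.conjH1 p κ.kerSubgroup (γ ^ p ^ n) (v : selmerAc W p κ 𝔭 S) = (v : selmerAc W p κ 𝔭 S) := by
    intro v
    rw [LinearMap.mem_ker, hN, sub_one_pow_prime_pow, LinearMap.sub_apply, sub_eq_zero, Module.End.one_apply,
      Subtype.ext_iff, Subtype.ext_iff, hφpow, coe_conjSelmerAc_pow_apply]
  let e : LinearMap.ker (N ^ p ^ n) ≃
      {s : selmerAc W p κ 𝔭 S // p • s = 0 ∧ W.conjH1 p κ.kerSubgroup (γ ^ p ^ n) s = s} :=
    { toFun := fun v => ⟨(v : Vsub), (hmemV _).mp (v : Vsub).2, (hker v).mp v.2⟩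
      invFun := fun s => ⟨⟨s.1, (hmemV _).mpr s.2.1⟩, (hker _).mpr s.2.2⟩
      left_inv := fun v => rfl
      right_inv := fun s => rfl }
  haveI : Finite {s : selmerAc W p κ 𝔭 S // p • s = 0 ∧ W.conjH1 p κ.kerSubgroup (γ ^ p ^ n) s = s} :=
    hfin.to_subtype
  haveI : Finite (LinearMap.ker (N ^ p ^ n)) := Finite.of_equiv _ e.symm
  have hcard : Nat.card (LinearMap.ker (N ^ p ^ n)) < Nat.card (ZMod p) ^ p ^ n := by
    rw [Nat.card_congr e, Nat.card_zmod]; exact hlt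
  have htop : LinearMap.ker (N ^ p ^ n) = ⊤ := ker_pow_eq_top_of_natCard_ker_pow_lt N hnil (p ^ n) hcard
  -- (1) the two sets agree
  have hsets : {s : selmerAc W p κ 𝔭 S | p • s = 0} =
      {s : selmerAc W p κ 𝔭 S | p • s = 0 ∧ W.conjH1 p κ.kerSubgroup (γ ^ p ^ n) s = s} := by
    ext s
    simp only [Set.mem_setOf_eq]
    constructor
    · intro hs
      have hv : (⟨s, (hmemV s).mpr hs⟩ : Vsub) ∈ LinearMap.ker (N ^ p ^ n) := by rw [htop]; exact Submodule.mem_top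
      exact ⟨hs, (hker _).mp hv⟩
    · exact fun h => h.1
  refine ⟨hsets, ?_⟩
  -- (2) the count
  have hcard' : Nat.card {s : selmerAc W p κ 𝔭 S // p • s = 0} =
      Nat.card {s : selmerAc W p κ 𝔭 S // p • s = 0 ∧ W.conjH1 p κ.kerSubgroup (γ ^ p ^ n) s = s} := by
    refine Nat.card_congr ⟨fun s => ⟨s.1, by have := s.2; rw [← Set.mem_setOf_eq (p := fun s => p • s = 0), hsets] at this; exact this⟩,
      fun s => ⟨s.1, s.2.1⟩, fun s => rfl, fun s => rfl⟩
  rw [hcard']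
  exact hlt

end Selmer

end Summit.BirchSwinnertonDyer.BirchSwinnertonDyer.Theorems.UniversalToricDescentOneLayerCriterion

end
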